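import Summits.ValiantsHypothesis.ValiantsHypothesis.Theorems.KPlusLogSqLawTridiagonalRealStaticOverlap

/-!
# Route «KPlusLogSqLaw», crux `WeakLifting` (stmt-ValiantsHypothesis-19561) — REAL side of the tridiagonal sector:
# the VERTEX EXPANSION of the continuant (all sizes) and the GEOGRAPHY OF THE ZEROS OF A `5 × 5` DESIGN by the two end `2 × 2` minors

HONEST FRAMING.  Helper theorems (`--supports stmt-ValiantsHypothesis-19561 --as helper`), seat val-sym-lift-p3 (g11), cell `pub-symmetroid`,
2026-08-28; Part 2 of the `m = 5` structure begun in `…TridiagonalRealStaticOverlap` (p590486: overlap identity, product form of the two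
`3 × 3` minors, class dichotomy).  STRUCTURE ONLY — no zero is counted; `B 5 ∈ [5, 7]` (kernel) is unchanged and the located value `5`
is not claimed.  The desk's «`B 5 ≤ 6`?» arena (R2375 (B)) needs, by the inertia walk, a bound on the CLASS-ONE zeros; this file pins down
WHERE class-one zeros can sit in terms of the leading `2 × 2` minor `D₂` and the trailing `2 × 2` minor `Δ = D⁽³⁾₂` (whose positive zeros are
the two «poles» `U₁ = 1`, `U₄ = 1` of the Schur form `U₂/(1−U₁) + U₃/(1−U₄) = 1` of the memos).  Nothing here bears on `WeakLifting` /
`TropicalB` (stmt-19771) in their windows, on Conjecture B, on the Door-A registers, on `MatrixDescartes` (stmt-ValiantsHypothesis-18050) or on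
VP ≠ VNP; α status NO MOVER.

WHAT IS PROVED (continuant currency `D_k = pathDet a d b f k`; `D⁽ᵘ⁾` = the design shifted by `u`).
1. **`pathDet_vertex_expand` (all sizes)** — expansion of `D_{s+3+n}` along the ROW of the vertex `c = s + 1`:
   `D_{s+3+n} = a_c X^{d_c} · D_{s+1} · D⁽ˢ⁺²⁾_{n+1} − (b_s X^{f_s})² · D_s · D⁽ˢ⁺²⁾_{n+1} − (b_{s+1} X^{f_{s+1}})² · D_{s+1} · D⁽ˢ⁺³⁾_n`
   (lift-p1 g13's edge splitting `pathDet_split_two_sided` followed by Part 1's first-row expansion `pathDet_shift_expand_first`);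
   `eval_pathDet_vertex_expand` is the evaluated form.
2. **`five_eval_vertex`** — `m = 5`, middle vertex: `D₅(x) = a₂x^{d₂}·D₂(x)·Δ(x) − b₁²a₀x^{2f₁+d₀}·Δ(x) − b₂²a₄x^{2f₂+d₄}·D₂(x)`, `Δ = D⁽³⁾₂`.
3. **`five_trailing_two_mul_three`** — AT A ZERO of `D₅`: `Δ(x) · D₃(x) = b₂² a₄ x^{2f₂+d₄} · D₂(x)` (trailing `2 × 2` × leading `3 × 3` is a
   positive multiple of the leading `2 × 2`), and its mirror `five_leading_two_mul_trailing_three`: `D₂(x) · D⁽²⁾₃(x) = b₁² a₀ x^{2f₁+d₀} · Δ(x)`.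
4. THE GEOGRAPHY (definite irreducible designs, positive zeros `x` of `D₅`):
   * `five_pole_law` — `D₂(x) = 0 ↔ Δ(x) = 0` (a zero of `D₅` lies on a pole of the Schur form only if it lies on BOTH poles);
   * `five_not_both_end_minors_neg` — NOT (`D₂(x) < 0` and `Δ(x) < 0`): the region where both end minors are negative carries no zero;
   * `five_class_zero_iff_end_minors` — `0 < D₃(x)` (class `0`, Part 1) `↔ 0 < D₂(x) ∧ 0 < Δ(x)`;
   * `five_class_one_iff_end_minors` — `D₃(x) < 0` (class `1`) `↔ D₂(x)·Δ(x) < 0 ∨ (D₂(x) = 0 ∧ Δ(x) = 0)`: every class-one zero sits where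
     the two end minors have OPPOSITE strict signs, or at a common zero of both (the «double pole»).
LOCATED CONTEXT (seat tools, memo HOME/val-sym-lift-p3/g11/memo-liftp3g11.md §4, not claimed): in a census of `5 × 5` designs the opposite-sign
regions carry at most `4` zeros each and at most `3` per monotonicity piece of the Schur form, the both-positive region at most `2` (kernel:
class `0 ≤ 2`), and never more than `5` in total (boost: `(Z₀, Z₁) = (0, 5)`; also `(2, 3)` attained).
[folklore: Laplace expansion of a tridiagonal determinant along a row; the `m = 5` sign bookkeeping is this seat's]
-/

-- `Summit.ValiantsHypothesis.ValiantsHypothesis.…` repeats a component by the D-0017 layout (single-conjunct summit); the name is mandated.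
set_option linter.dupNamespace false
set_option autoImplicit false

namespace Summit.ValiantsHypothesis.ValiantsHypothesis.Theorems.KPlusLogSqLaw

namespace StaticTridiagonalRealOverlap

open Polynomial
open Summit.ValiantsHypothesis.ValiantsHypothesis.Theorems.KPlusLogSqLaw.StaticTridiagonalRealPotential
  (pathDet pathDet_zero pathDet_one pathDet_add_two pathDet_congr eval_pathDet_add_two
    eval_ne_zero_of_eval_add_two_eq_zero eval_succ_mul_eval_pos_of_root)
open Summit.ValiantsHypothesis.ValiantsHypothesis.Theorems.KPlusLogSqLaw.StaticTridiagonalRealCut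
  (pathDet_split_two_sided)

variable (a : ℕ → ℝ) (d : ℕ → ℕ) (b : ℕ → ℝ) (f : ℕ → ℕ)

/-! ### §1 The vertex expansion (all sizes) -/

/-- **VERTEX EXPANSION of the continuant** along the row of the vertex `c = s + 1` (size `m = s + 3 + n`):
`D_m = a_c X^{d_c}·D_{s+1}·D⁽ˢ⁺²⁾_{n+1} − (b_s X^{f_s})²·D_s·D⁽ˢ⁺²⁾_{n+1} − (b_{s+1} X^{f_{s+1}})²·D_{s+1}·D⁽ˢ⁺³⁾_n`.
[folklore; lift-p1 g13's `pathDet_split_two_sided` + Part 1's `pathDet_shift_expand_first`] -/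
theorem pathDet_vertex_expand (s n : ℕ) :
    pathDet a d b f (s + 3 + n) =
      (C (a (s + 1)) * X ^ d (s + 1)) * pathDet a d b f (s + 1) *
          pathDet (fun t => a (t + (s + 2))) (fun t => d (t + (s + 2))) (fun t => b (t + (s + 2))) (fun t => f (t + (s + 2)))
            (n + 1) -
        (C (b s) * X ^ f s) ^ 2 * pathDet a d b f s *
          pathDet (fun t => a (t + (s + 2))) (fun t => d (t + (s + 2))) (fun t => b (t + (s + 2))) (fun t => f (t + (s + 2)))
            (n + 1) -
        (C (b (s + 1)) * X ^ f (s + 1)) ^ 2 * pathDet a d b f (s + 1) *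
          pathDet (fun t => a (t + (s + 3))) (fun t => d (t + (s + 3))) (fun t => b (t + (s + 3))) (fun t => f (t + (s + 3))) n := by
  have h2 := pathDet_split_two_sided a d b f s (n + 1)
  rw [show s + 2 + (n + 1) = s + 3 + n by omega, show n + 1 + 1 = n + 2 from rfl] at h2
  have h3 := pathDet_shift_expand_first a d b f (s + 1) n
  rw [show s + 1 + 1 = s + 2 from rfl, show s + 1 + 2 = s + 3 from rfl] at h3
  rw [h2, h3]
  ring

/-- The vertex expansion, evaluated at a real point. -/
theorem eval_pathDet_vertex_expand (s n : ℕ) (x : ℝ) :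
    (pathDet a d b f (s + 3 + n)).eval x =
      a (s + 1) * x ^ d (s + 1) * (pathDet a d b f (s + 1)).eval x *
          (pathDet (fun t => a (t + (s + 2))) (fun t => d (t + (s + 2))) (fun t => b (t + (s + 2))) (fun t => f (t + (s + 2)))
            (n + 1)).eval x -
        (b s * x ^ f s) ^ 2 * (pathDet a d b f s).eval x *
          (pathDet (fun t => a (t + (s + 2))) (fun t => d (t + (s + 2))) (fun t => b (t + (s + 2))) (fun t => f (t + (s + 2)))
            (n + 1)).eval x -
        (b (s + 1) * x ^ f (s + 1)) ^ 2 * (pathDet a d b f (s + 1)).eval x *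
          (pathDet (fun t => a (t + (s + 3))) (fun t => d (t + (s + 3))) (fun t => b (t + (s + 3))) (fun t => f (t + (s + 3)))
            n).eval x := by
  have h := congrArg (fun P => Polynomial.eval x P) (pathDet_vertex_expand a d b f s n)
  simpa only [eval_mul, eval_sub, eval_pow, eval_C, eval_X] using h

/-! ### §2 Size five: the middle-vertex expansion and the two end minors at a zero -/

/-- **`m = 5`, expansion along the middle row**: `D₅(x) = a₂x^{d₂}·D₂(x)·Δ(x) − (b₁x^{f₁})²·(a₀x^{d₀})·Δ(x) − (b₂x^{f₂})²·D₂(x)·(a₄x^{d₄})`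
with `Δ = D⁽³⁾₂` the trailing `2 × 2` minor. -/
theorem five_eval_vertex (x : ℝ) :
    (pathDet a d b f 5).eval x =
      a 2 * x ^ d 2 * (pathDet a d b f 2).eval x *
          (pathDet (fun t => a (t + 3)) (fun t => d (t + 3)) (fun t => b (t + 3)) (fun t => f (t + 3)) 2).eval x -
        (b 1 * x ^ f 1) ^ 2 * (a 0 * x ^ d 0) *
          (pathDet (fun t => a (t + 3)) (fun t => d (t + 3)) (fun t => b (t + 3)) (fun t => f (t + 3)) 2).eval x -
        (b 2 * x ^ f 2) ^ 2 * (pathDet a d b f 2).eval x * (a 4 * x ^ d 4) := by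
  have h := eval_pathDet_vertex_expand a d b f 1 1 x
  rw [pathDet_one, pathDet_one] at h
  simpa only [eval_mul, eval_C, eval_pow, eval_X, zero_add] using h

/-- **At a zero of `D₅`: `Δ(x) · D₃(x) = (b₂x^{f₂})² (a₄x^{d₄}) · D₂(x)`** — the trailing `2 × 2` minor times the leading `3 × 3` minor is a
nonnegative multiple (positive for definite irreducible designs and `x ≠ 0`) of the leading `2 × 2` minor. -/
theorem five_trailing_two_mul_three {x : ℝ} (hroot : (pathDet a d b f 5).eval x = 0) :
    (pathDet (fun t => a (t + 3)) (fun t => d (t + 3)) (fun t => b (t + 3)) (fun t => f (t + 3)) 2).eval x *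
        (pathDet a d b f 3).eval x =
      (b 2 * x ^ f 2) ^ 2 * (a 4 * x ^ d 4) * (pathDet a d b f 2).eval x := by
  have h := five_eval_vertex a d b f x
  rw [hroot] at h
  have e3 := eval_pathDet_add_two a d b f 1 x
  rw [show 1 + 2 = 3 from rfl, show 1 + 1 = 2 from rfl, pathDet_one, eval_mul, eval_C, eval_pow, eval_X] at e3
  rw [e3]
  linear_combination -h

/-- **Mirror form at a zero of `D₅`: `D₂(x) · D⁽²⁾₃(x) = (b₁x^{f₁})² (a₀x^{d₀}) · Δ(x)`** — leading `2 × 2` times trailing `3 × 3` is a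
nonnegative multiple of the trailing `2 × 2` minor. -/
theorem five_leading_two_mul_trailing_three {x : ℝ} (hroot : (pathDet a d b f 5).eval x = 0) :
    (pathDet a d b f 2).eval x *
        (pathDet (fun t => a (t + 2)) (fun t => d (t + 2)) (fun t => b (t + 2)) (fun t => f (t + 2)) 3).eval x =
      (b 1 * x ^ f 1) ^ 2 * (a 0 * x ^ d 0) *
        (pathDet (fun t => a (t + 3)) (fun t => d (t + 3)) (fun t => b (t + 3)) (fun t => f (t + 3)) 2).eval x := by
  have h := five_eval_vertex a d b f x
  rw [hroot] at h
  -- first-row expansion of the trailing `3 × 3` minor: `D⁽²⁾₃ = a₂x^{d₂}·Δ − (b₂x^{f₂})²·a₄x^{d₄}`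
  have e3 := congrArg (fun P => Polynomial.eval x P) (pathDet_shift_expand_first a d b f 2 1)
  simp only [eval_mul, eval_sub, eval_pow, eval_C, eval_X, Nat.reduceAdd] at e3
  have e1 : (pathDet (fun t => a (t + 4)) (fun t => d (t + 4)) (fun t => b (t + 4)) (fun t => f (t + 4)) 1).eval x =
      a 4 * x ^ d 4 := by
    rw [pathDet_one, eval_mul, eval_C, eval_pow, eval_X]
  rw [e1] at e3
  rw [e3]
  linear_combination -h

/-! ### §3 The geography of the zeros of a definite irreducible `5 × 5` design -/

/-- **POLE LAW**: at a positive zero of `D₅` the leading `2 × 2` minor vanishes iff the trailing one does (a zero on the pole `U₁ = 1` of the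
Schur form lies on the pole `U₄ = 1` as well). -/
theorem five_pole_law (ha : ∀ t, 0 < a t) (hb : ∀ t, b t ≠ 0) {x : ℝ} (hx : 0 < x)
    (hroot : (pathDet a d b f 5).eval x = 0) :
    (pathDet a d b f 2).eval x = 0 ↔
      (pathDet (fun t => a (t + 3)) (fun t => d (t + 3)) (fun t => b (t + 3)) (fun t => f (t + 3)) 2).eval x = 0 := by
  have h3 : (pathDet a d b f 3).eval x ≠ 0 := eval_ne_zero_of_eval_add_two_eq_zero a d b f ha hb 3 hx hroot
  have hA : (b 2 * x ^ f 2) ^ 2 * (a 4 * x ^ d 4) ≠ 0 := by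
    have h1 : b 2 * x ^ f 2 ≠ 0 := mul_ne_zero (hb 2) (pow_ne_zero _ hx.ne')
    exact mul_ne_zero (pow_ne_zero _ h1) (mul_ne_zero (ha 4).ne' (pow_ne_zero _ hx.ne'))
  have key := five_trailing_two_mul_three a d b f hroot
  constructor
  · intro h2
    rw [h2, mul_zero] at key
    rcases mul_eq_zero.1 key with h | h
    · exact h
    · exact absurd h h3
  · intro hΔ
    rw [hΔ, zero_mul] at key
    rcases mul_eq_zero.1 key.symm with h | h
    · exact absurd h hA
    · exact h

/-- **The both-negative region is empty**: at a positive zero of `D₅` the two end `2 × 2` minors are not both negative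
(in the memos' census: region `R₁₁` carries no zero). -/
theorem five_not_both_end_minors_neg (ha : ∀ t, 0 < a t) (hb : ∀ t, b t ≠ 0) {x : ℝ} (hx : 0 < x)
    (hroot : (pathDet a d b f 5).eval x = 0) :
    ¬ ((pathDet a d b f 2).eval x < 0 ∧
        (pathDet (fun t => a (t + 3)) (fun t => d (t + 3)) (fun t => b (t + 3)) (fun t => f (t + 3)) 2).eval x < 0) := by
  rintro ⟨h2, hΔ⟩
  have h := five_eval_vertex a d b f x
  rw [hroot] at h
  have hA2 : 0 < a 2 * x ^ d 2 := mul_pos (ha 2) (pow_pos hx _)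
  have hB1 : 0 < (b 1 * x ^ f 1) ^ 2 * (a 0 * x ^ d 0) := by
    have h1 : b 1 * x ^ f 1 ≠ 0 := mul_ne_zero (hb 1) (pow_ne_zero _ hx.ne')
    have : 0 < a 0 * x ^ d 0 := mul_pos (ha 0) (pow_pos hx _)
    positivity
  have hB2 : 0 < (b 2 * x ^ f 2) ^ 2 * (a 4 * x ^ d 4) := by
    have h1 : b 2 * x ^ f 2 ≠ 0 := mul_ne_zero (hb 2) (pow_ne_zero _ hx.ne')
    have : 0 < a 4 * x ^ d 4 := mul_pos (ha 4) (pow_pos hx _)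
    positivity
  -- every term on the right of the expansion is positive
  have t1 : 0 < a 2 * x ^ d 2 * (pathDet a d b f 2).eval x *
      (pathDet (fun t => a (t + 3)) (fun t => d (t + 3)) (fun t => b (t + 3)) (fun t => f (t + 3)) 2).eval x := by
    have := mul_pos_of_neg_of_neg h2 hΔ
    rw [mul_assoc]; exact mul_pos hA2 this
  nlinarith [mul_pos_of_neg_of_neg (neg_neg_of_pos hB1) hΔ, mul_pos_of_neg_of_neg (neg_neg_of_pos hB2) h2]

/-- **CLASS ZERO ⇔ BOTH END MINORS POSITIVE**: at a positive zero of a definite irreducible `D₅`, the leading `3 × 3` minor is positive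
(class `0`, `five_class_zero_iff`) iff the leading AND the trailing `2 × 2` minors are positive. -/
theorem five_class_zero_iff_end_minors (ha : ∀ t, 0 < a t) (hb : ∀ t, b t ≠ 0) {x : ℝ} (hx : 0 < x)
    (hroot : (pathDet a d b f 5).eval x = 0) :
    0 < (pathDet a d b f 3).eval x ↔
      0 < (pathDet a d b f 2).eval x ∧
        0 < (pathDet (fun t => a (t + 3)) (fun t => d (t + 3)) (fun t => b (t + 3)) (fun t => f (t + 3)) 2).eval x := by
  have key := five_trailing_two_mul_three a d b f hroot
  have hB2 : 0 < (b 2 * x ^ f 2) ^ 2 * (a 4 * x ^ d 4) := by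
    have h1 : b 2 * x ^ f 2 ≠ 0 := mul_ne_zero (hb 2) (pow_ne_zero _ hx.ne')
    have : 0 < a 4 * x ^ d 4 := mul_pos (ha 4) (pow_pos hx _)
    positivity
  constructor
  · intro h3
    have h2 : 0 < (pathDet a d b f 2).eval x := (five_class_zero_iff a d b f ha hb hx hroot).1 h3 2 (by norm_num)
    refine ⟨h2, ?_⟩
    have : 0 < (pathDet (fun t => a (t + 3)) (fun t => d (t + 3)) (fun t => b (t + 3)) (fun t => f (t + 3)) 2).eval x *
        (pathDet a d b f 3).eval x := by rw [key]; exact mul_pos hB2 h2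
    exact (mul_pos_iff_of_pos_right h3).mp this
  · rintro ⟨h2, hΔ⟩
    have : 0 < (pathDet (fun t => a (t + 3)) (fun t => d (t + 3)) (fun t => b (t + 3)) (fun t => f (t + 3)) 2).eval x *
        (pathDet a d b f 3).eval x := by rw [key]; exact mul_pos hB2 h2
    exact (mul_pos_iff_of_pos_left hΔ).mp this

/-- **CLASS ONE ⇔ END MINORS OF OPPOSITE SIGN (or a double pole)**: at a positive zero of a definite irreducible `D₅`, the leading `3 × 3`
minor is negative (class `1`, `five_class_one`) iff the two end `2 × 2` minors have opposite strict signs or both vanish.  So the class-one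
zeros live in the two «mixed» regions of the Schur form and on the double pole — nowhere else. -/
theorem five_class_one_iff_end_minors (ha : ∀ t, 0 < a t) (hb : ∀ t, b t ≠ 0) {x : ℝ} (hx : 0 < x)
    (hroot : (pathDet a d b f 5).eval x = 0) :
    (pathDet a d b f 3).eval x < 0 ↔
      (pathDet a d b f 2).eval x *
            (pathDet (fun t => a (t + 3)) (fun t => d (t + 3)) (fun t => b (t + 3)) (fun t => f (t + 3)) 2).eval x < 0 ∨
        ((pathDet a d b f 2).eval x = 0 ∧
          (pathDet (fun t => a (t + 3)) (fun t => d (t + 3)) (fun t => b (t + 3)) (fun t => f (t + 3)) 2).eval x = 0) := by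
  have key := five_trailing_two_mul_three a d b f hroot
  have h3ne : (pathDet a d b f 3).eval x ≠ 0 := eval_ne_zero_of_eval_add_two_eq_zero a d b f ha hb 3 hx hroot
  have hB2 : 0 < (b 2 * x ^ f 2) ^ 2 * (a 4 * x ^ d 4) := by
    have h1 : b 2 * x ^ f 2 ≠ 0 := mul_ne_zero (hb 2) (pow_ne_zero _ hx.ne')
    have : 0 < a 4 * x ^ d 4 := mul_pos (ha 4) (pow_pos hx _)
    positivity
  set D2 := (pathDet a d b f 2).eval x with hD2
  set D3 := (pathDet a d b f 3).eval x with hD3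
  set Δ := (pathDet (fun t => a (t + 3)) (fun t => d (t + 3)) (fun t => b (t + 3)) (fun t => f (t + 3)) 2).eval x with hΔ
  -- `Δ · D3 = c · D2` with `c > 0`
  constructor
  · intro h3
    rcases lt_trichotomy D2 0 with h2 | h2 | h2
    · -- `D2 < 0 ⇒ Δ·D3 < 0 ⇒ Δ > 0`
      left
      have : Δ * D3 < 0 := by rw [key]; exact mul_neg_of_pos_of_neg hB2 h2
      have hΔpos : 0 < Δ := by
        by_contra hle; push Not at hle
        exact absurd this (not_lt.2 (mul_nonneg_of_nonpos_of_nonpos hle h3.le))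
      exact mul_neg_of_neg_of_pos h2 hΔpos
    · right
      exact ⟨h2, (five_pole_law a d b f ha hb hx hroot).1 h2⟩
    · left
      have : 0 < Δ * D3 := by rw [key]; exact mul_pos hB2 h2
      have hΔneg : Δ < 0 := by
        by_contra hle; push Not at hle
        exact absurd this (not_lt.2 (mul_nonpos_of_nonneg_of_nonpos hle h3.le))
      exact mul_neg_of_pos_of_neg h2 hΔneg
  · intro h
    rcases lt_trichotomy D3 0 with h3 | h3 | h3
    · exact h3
    · exact absurd h3 h3ne
    · exfalso
      have hpos := (five_class_zero_iff_end_minors a d b f ha hb hx hroot).1 h3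
      rcases h with h | ⟨h2, _⟩
      · exact absurd h (not_lt.2 (mul_pos hpos.1 hpos.2).le)
      · exact absurd h2 hpos.1.ne'

end StaticTridiagonalRealOverlap

end Summit.ValiantsHypothesis.ValiantsHypothesis.Theorems.KPlusLogSqLaw
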